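import Literature.Probability.RandomPlanarGeometry.SAWLoopErasureKestenRenewalGreenChernoff
import Literature.Probability.RandomPlanarGeometry.SAWLoopErasureKestenRenewalThird
import HarnessLib

/-!
# The Kesten envelope `|μ(ℤ^d) − (2d − 1 − 1/(2d))| ≤ 5/d²` for every `d ≥ 2`

Topic `Literature/Probability/RandomPlanarGeometry`; the def-free heir of `SAWLoopErasureKestenRenewalGreenChernoff.lean` announced
in its docstring: the exact sixth return probability
`srwLaw_six_zero (hd : 1 ≤ d) : p₆(0) = 15/(8d³) − 45/(16d⁴) + 5/(4d⁵)` (`SAWLoopErasureKestenRenewalThird.lean`) is plugged into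
`GreenChernoff.srwI_one_le_sixth_add (hd : 22 ≤ d) : G_d ≤ 1 + 1/(2d) + (3/(4d²) − 3/(8d³)) + p₆(0) + 51/d⁴`.

* `GreenChernoff.srwI_one_le_sharp₄ (hd : 22 ≤ d) : G_d ≤ 1 + 1/(2d) + 3/(4d²) + 3/(2d³) + 49/d⁴`
  (`51 − 45/16 + 5/(4d) ≤ 49` for `d ≥ 2`; the true `d⁻⁴` coefficient is `15/4`).
* `GreenChernoff.kesten_renewal_sharp₄ (hd : 22 ≤ d) : 2d − 1 − 1/(2d) − 1/d² − 94/d³ ≤ μ(ℤ^d)` — the plug-in `(0,1)` bound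
  `two_mul_div_renewal_le_connectiveConstant_of_le`; floor algebra `2dB − P(2B − 1) = (3d⁴/4 + 195d³ + 193d² + 380d + 9212)/d⁷ ≥ 0`
  (`94` is the least integer for which every coefficient is non-negative).  Against the tree: `kesten_second_order_renewal_sharp₉`
  (`… − 1/d² − 9/d³ − 204704/d⁴`) and `kesten_third_order_renewal_sharp₁₁` (`… − 1/d² − 11/(4d³) − 49/d⁴ − 2249392/d⁵`) are weaker
  exactly for `22 ≤ d ≤ 157`, and `GreenChernoff.kesten_renewal_chernoff₃` (`… − 14/d² − 120/d³`) for every `d ≥ 22`.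
* `GreenChernoff.twoTerm_sub_five_div_sq_le_connectiveConstant_of_le (hd : 22 ≤ d) : 2d − 1 − 1/(2d) − 5/d² ≤ μ(ℤ^d)`
  (`2dB − P(2B − 1) = (4d⁴ − 357d³/4 + 107d² + 64d + 490)/d⁶`, non-negative for `d ≥ 22` since `4d² − 357d/4 + 107 > 0` there).
* **`twoTerm_sub_five_div_sq_le_connectiveConstant (hd : 2 ≤ d)`** (`3 ≤ d ≤ 21`: the certified floors `renewalFloor_le_connectiveConstant`,
  smallest slack `0.0086` at `d = 21`; `d = 2`: `3/2 ≤ 2 ≤ μ(ℤ²)` by `natCast_le_connectiveConstant`) and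
  **`abs_connectiveConstant_sub_twoTerm_le_five_div_sq (hd : 2 ≤ d) : |μ(ℤ^d) − (2d − 1 − 1/(2d))| ≤ 5/d²`** (upper side:
  `connectiveConstant_lt_twoTerm`).  The constant `5` is forced by the table end (`d = 21`: slack `0.0086`) and by `d = 22`, not by the
  asymptotics: the true next term of the `1/d` expansion is `−3/(2d)² = −(3/4)/d²` (the shape of the tree's ceiling
  `connectiveConstant_le_thirdOrder`), so any envelope `c/d²` needs `c ≥ 3/4`.

* `abs_connectiveConstant_succ_sub_sub_two_le (hd : 2 ≤ d) : |μ(ℤ^{d+1}) − μ(ℤ^d) − 2| ≤ 11/d²` — Kesten's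
  `μ(ℤ^{d+1}) − μ(ℤ^d) → 2` made effective in every dimension.

HONEST SCOPE: arithmetic on top of the two named inputs; no new mathematics about `μ`.  Envelope constants in the tree before this
file: `4559` (`abs_connectiveConstant_sub_two_le_all`), `20` (`abs_connectiveConstant_sub_twoTerm_le_twenty_div_sq`).
-/

namespace Literature.Probability.RandomPlanarGeometry.SAW.Zd.LoopErasure

open Literature.Probability.FitznerVanDerHofstad2017
open Literature.Barriers.CriticalPhenomena.LongRangePhi4 (srwLaw)

variable {d : ℕ}

namespace GreenChernoff

/-- **Green-function enclosure to fourth order** (`d ≥ 22`): `G_d ≤ 1 + 1/(2d) + 3/(4d²) + 3/(2d³) + 49/d⁴`.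
[cite: HaraSladeSokal1993, Appendix A.1 pp. 28–30 and Table 4 (C₀(0,0;1/2d) = G_d, via the Bessel representation); lane certificate] -/
theorem srwI_one_le_sharp₄ (hd : 22 ≤ d) :
    srwI d 1 0 0 ≤ 1 + 1 / (2 * (d : ℝ)) + 3 / (4 * (d : ℝ) ^ 2) + 3 / (2 * (d : ℝ) ^ 3) + 49 / (d : ℝ) ^ 4 := by
  have hd0 : (0 : ℝ) < d := by exact_mod_cast (show 0 < d by omega)
  have hd22 : (22 : ℝ) ≤ d := by exact_mod_cast hd
  have h1 := srwI_one_le_sixth_add hd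
  rw [srwLaw_six_zero (by omega)] at h1
  have h5 : (5 : ℝ) / (4 * (d : ℝ) ^ 5) ≤ 13 / (16 * (d : ℝ) ^ 4) := by
    rw [div_le_div_iff₀ (by positivity) (by positivity)]
    nlinarith [pow_pos hd0 4]
  have e1 : (3 : ℝ) / (2 * (d : ℝ) ^ 3) = -(3 / (8 * (d : ℝ) ^ 3)) + 15 / (8 * (d : ℝ) ^ 3) := by
    field_simp; ring
  have e2 : (49 : ℝ) / (d : ℝ) ^ 4 = -(45 / (16 * (d : ℝ) ^ 4)) + 13 / (16 * (d : ℝ) ^ 4) + 51 / (d : ℝ) ^ 4 := by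
    field_simp; ring
  linarith

/-- **Renewal floor to third order with a clean remainder** (`d ≥ 22`): `2d − 1 − 1/(2d) − 1/d² − 94/d³ ≤ μ(ℤ^d)`.
[cite: HaraSladeSokal1993, §2.2 eq. (2.32) (the (0,1) bound) and Table 2 ((0,1) row); lane certificate] -/
theorem kesten_renewal_sharp₄ (hd : 22 ≤ d) :
    2 * (d : ℝ) - 1 - 1 / (2 * (d : ℝ)) - 1 / (d : ℝ) ^ 2 - 94 / (d : ℝ) ^ 3 ≤ connectiveConstant d := by
  have hd0 : (0 : ℝ) < d := by exact_mod_cast (show 0 < d by omega)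
  refine le_trans ?_ (two_mul_div_renewal_le_connectiveConstant_of_le (by omega) (srwI_one_le_sharp₄ hd))
  have hB : (1 : ℝ) ≤ 1 + 1 / (2 * (d : ℝ)) + 3 / (4 * (d : ℝ) ^ 2) + 3 / (2 * (d : ℝ) ^ 3) + 49 / (d : ℝ) ^ 4 := by
    have : (0 : ℝ) ≤ 1 / (2 * (d : ℝ)) + 3 / (4 * (d : ℝ) ^ 2) + 3 / (2 * (d : ℝ) ^ 3) + 49 / (d : ℝ) ^ 4 := by
      positivity
    linarith
  refine le_renewal_floor_of hB ?_
  rw [← sub_nonneg]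
  have key : 2 * (d : ℝ) * (1 + 1 / (2 * (d : ℝ)) + 3 / (4 * (d : ℝ) ^ 2) + 3 / (2 * (d : ℝ) ^ 3) + 49 / (d : ℝ) ^ 4) -
      (2 * (d : ℝ) - 1 - 1 / (2 * (d : ℝ)) - 1 / (d : ℝ) ^ 2 - 94 / (d : ℝ) ^ 3) *
        (2 * (1 + 1 / (2 * (d : ℝ)) + 3 / (4 * (d : ℝ) ^ 2) + 3 / (2 * (d : ℝ) ^ 3) + 49 / (d : ℝ) ^ 4) - 1) =
      (3 / 4 * (d : ℝ) ^ 4 + 195 * (d : ℝ) ^ 3 + 193 * (d : ℝ) ^ 2 + 380 * d + 9212) / (d : ℝ) ^ 7 := by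
    field_simp
    ring
  rw [key]
  positivity

/-- **Envelope floor with constant 5** (`d ≥ 22`): `2d − 1 − 1/(2d) − 5/d² ≤ μ(ℤ^d)`.
[cite: HaraSladeSokal1993, §2.2 eq. (2.32) (the (0,1) bound) and Table 2 ((0,1) row); lane certificate] -/
theorem twoTerm_sub_five_div_sq_le_connectiveConstant_of_le (hd : 22 ≤ d) :
    2 * (d : ℝ) - 1 - 1 / (2 * (d : ℝ)) - 5 / (d : ℝ) ^ 2 ≤ connectiveConstant d := by
  have hd0 : (0 : ℝ) < d := by exact_mod_cast (show 0 < d by omega)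
  have hd22 : (22 : ℝ) ≤ d := by exact_mod_cast hd
  refine le_trans ?_ (two_mul_div_renewal_le_connectiveConstant_of_le (by omega) (srwI_one_le_sharp₄ hd))
  have hB : (1 : ℝ) ≤ 1 + 1 / (2 * (d : ℝ)) + 3 / (4 * (d : ℝ) ^ 2) + 3 / (2 * (d : ℝ) ^ 3) + 49 / (d : ℝ) ^ 4 := by
    have : (0 : ℝ) ≤ 1 / (2 * (d : ℝ)) + 3 / (4 * (d : ℝ) ^ 2) + 3 / (2 * (d : ℝ) ^ 3) + 49 / (d : ℝ) ^ 4 := by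
      positivity
    linarith
  refine le_renewal_floor_of hB ?_
  rw [← sub_nonneg]
  have key : 2 * (d : ℝ) * (1 + 1 / (2 * (d : ℝ)) + 3 / (4 * (d : ℝ) ^ 2) + 3 / (2 * (d : ℝ) ^ 3) + 49 / (d : ℝ) ^ 4) -
      (2 * (d : ℝ) - 1 - 1 / (2 * (d : ℝ)) - 5 / (d : ℝ) ^ 2) *
        (2 * (1 + 1 / (2 * (d : ℝ)) + 3 / (4 * (d : ℝ) ^ 2) + 3 / (2 * (d : ℝ) ^ 3) + 49 / (d : ℝ) ^ 4) - 1) =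
      (4 * (d : ℝ) ^ 4 - 357 / 4 * (d : ℝ) ^ 3 + 107 * (d : ℝ) ^ 2 + 64 * d + 490) / (d : ℝ) ^ 6 := by
    field_simp
    ring
  rw [key]
  refine div_nonneg ?_ (by positivity)
  have h22 : (0 : ℝ) ≤ (d : ℝ) - 22 := by linarith
  nlinarith [mul_nonneg (sq_nonneg (d : ℝ)) (sq_nonneg ((d : ℝ) - 22)), mul_nonneg (sq_nonneg (d : ℝ)) h22,
    sq_nonneg (d : ℝ), h22]

end GreenChernoff

/-- **Threshold-free lower envelope with constant 5**: `2d − 1 − 1/(2d) − 5/d² ≤ μ(ℤ^d)` for every `d ≥ 2` (`d ≥ 22`: the sharp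
floor; `3 ≤ d ≤ 21`: the certified floors `renewalFloor_le_connectiveConstant`; `d = 2`: `3/2 ≤ 2 ≤ μ(ℤ²)`).
[cite: HaraSladeSokal1993, §2.2 eq. (2.32) (the (0,1) bound) and Table 2 ((0,1) row); lane certificate] -/
theorem twoTerm_sub_five_div_sq_le_connectiveConstant (hd : 2 ≤ d) :
    2 * (d : ℝ) - 1 - 1 / (2 * (d : ℝ)) - 5 / (d : ℝ) ^ 2 ≤ connectiveConstant d := by
  rcases Nat.lt_or_ge d 22 with hlt | hge
  · rcases Nat.lt_or_ge d 3 with h3 | h3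
    · interval_cases d
      have h := natCast_le_connectiveConstant 2
      norm_num at h ⊢
      linarith
    · have hle : d ≤ 21 := by omega
      refine le_trans ?_ (renewalFloor_le_connectiveConstant h3 hle)
      interval_cases d <;> norm_num [renewalFloor]
  · exact GreenChernoff.twoTerm_sub_five_div_sq_le_connectiveConstant_of_le hge

/-- **The Kesten envelope with constant 5, for every `d ≥ 2`**: `|μ(ℤ^d) − (2d − 1 − 1/(2d))| ≤ 5/d²`.
[cite: HaraSladeSokal1993, §2.2 eq. (2.32) (the (0,1) bound) and Table 2 ((0,1) row); lane certificate] -/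
theorem abs_connectiveConstant_sub_twoTerm_le_five_div_sq (hd : 2 ≤ d) :
    |connectiveConstant d - (2 * d - 1 - 1 / (2 * (d : ℝ)))| ≤ 5 / (d : ℝ) ^ 2 := by
  have h1 := twoTerm_sub_five_div_sq_le_connectiveConstant hd
  have h2 := connectiveConstant_lt_twoTerm hd
  have h0 : (0 : ℝ) ≤ 5 / (d : ℝ) ^ 2 := by positivity
  rw [abs_le]
  constructor <;> linarith

/-- **Dimension gap**: `|μ(ℤ^{d+1}) − μ(ℤ^d) − 2| ≤ 11/d²` for every `d ≥ 2` (the two envelopes at `d` and `d + 1`: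
`2 + 1/(2d(d+1)) ± (5/d² + 5/(d+1)²)`).  Kesten's `μ(ℤ^{d+1}) − μ(ℤ^d) → 2`, made effective.
[cite: HaraSladeSokal1993, §2.2 eq. (2.32) (the (0,1) bound) and Table 2 ((0,1) row); lane certificate] -/
theorem abs_connectiveConstant_succ_sub_sub_two_le (hd : 2 ≤ d) :
    |connectiveConstant (d + 1) - connectiveConstant d - 2| ≤ 11 / (d : ℝ) ^ 2 := by
  have hd0 : (0 : ℝ) < d := by exact_mod_cast (show 0 < d by omega)
  have hd2 : (2 : ℝ) ≤ d := by exact_mod_cast hd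
  have h1 := abs_connectiveConstant_sub_twoTerm_le_five_div_sq hd
  have h2 := abs_connectiveConstant_sub_twoTerm_le_five_div_sq (d := d + 1) (by omega)
  push_cast at h2
  rw [abs_le] at h1 h2 ⊢
  obtain ⟨h1l, h1u⟩ := h1
  obtain ⟨h2l, h2u⟩ := h2
  have e5 : (5 : ℝ) / ((d : ℝ) + 1) ^ 2 ≤ 5 / (d : ℝ) ^ 2 :=
    div_le_div_of_nonneg_left (by norm_num) (by positivity) (by nlinarith)
  have egap : (1 : ℝ) / (2 * (d : ℝ)) - 1 / (2 * ((d : ℝ) + 1)) = 1 / (2 * (d : ℝ) * ((d : ℝ) + 1)) := by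
    field_simp
    ring
  have egap0 : (0 : ℝ) ≤ 1 / (2 * (d : ℝ) * ((d : ℝ) + 1)) := by positivity
  have egap1 : (1 : ℝ) / (2 * (d : ℝ) * ((d : ℝ) + 1)) ≤ 1 / (d : ℝ) ^ 2 :=
    div_le_div_of_nonneg_left (by norm_num) (by positivity) (by nlinarith)
  have hd2i : (0 : ℝ) ≤ 1 / (d : ℝ) ^ 2 := by positivity
  have e11 : (11 : ℝ) / (d : ℝ) ^ 2 = 5 / (d : ℝ) ^ 2 + 5 / (d : ℝ) ^ 2 + 1 / (d : ℝ) ^ 2 := by ring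
  constructor
  · have key : -(11 / (d : ℝ) ^ 2) ≤
        (1 / (2 * (d : ℝ)) - 1 / (2 * ((d : ℝ) + 1))) - 5 / ((d : ℝ) + 1) ^ 2 - 5 / (d : ℝ) ^ 2 := by
      rw [egap, e11]; linarith
    linarith
  · have key : (1 / (2 * (d : ℝ)) - 1 / (2 * ((d : ℝ) + 1))) + 5 / ((d : ℝ) + 1) ^ 2 + 5 / (d : ℝ) ^ 2 ≤
        11 / (d : ℝ) ^ 2 := by
      rw [egap, e11]; linarith
    linarith

end Literature.Probability.RandomPlanarGeometry.SAW.Zd.LoopErasure
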